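import Summits.QuantumFields.YangMills.Theorems.AllWindowsColdBoxBoxHighLineFPRepresentationPrelims

/-!
# T-S5.5J `fpRepresentation : FPRepresentation` — the Faddeev–Popov representation of gauge-invariant box expectations

The typed task of planner ym-idea-2 g18 (`Cruxes/BoxHighWindowsSU22/TaskS5Step2Rep.lean`; tree copy ✓`…FPRepresentationDefs`), BY NAME:
for a gauge-invariant observable `0 ≤ F ≤ 1` of the cold box,

  `| E_box[F] − E_box[F · h_J · 1_SP] / E_box[h_J · 1_SP] | ≤ 4δ + 4·P_box(¬SP)`

(`h_J = jacWeight β H r`, `SP = SmallPlaquettes H spl`), given (i) a Landau representative with `r₀`-small box links for every cold-wall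
small-plaquette configuration and (ii) `|N_J(V)/Z₀ − 1| ≤ δ ≤ 1/2` for every such representative.

Proof (the planner's design note, with NO `ε → 0`): the EXACT smeared FP identity without positivity ✓`FPExact.integral_mul_div_orbitAverage_eq`
(`∫ G·h/N_h = ∫ G·1_{N_h ≠ 0}`, fcl-p3 ✓p739859) applied to the invariant observables `G = F·1_SP` and `G = 1_SP`; ON `SP ∩ ColdWall` the
normaliser is `N_J(U) = N_J(U^g) ∈ Z₀[1−δ, 1+δ]` by (i)+(ii) and the invariance ✓`FPExact.orbitAverage_gaugeTransformZd_of_isInteriorGauge`, and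
the cold wall holds a.s. (DLR properness ✓`isSpecification_ymSpecification_of_t2Space`); hence the two sandwiches
`Z₀(1−δ)·E[F 1_SP] ≤ E[F h_J 1_SP] ≤ Z₀(1+δ)·E[F 1_SP]`, `Z₀(1−δ)·P(SP) ≤ E[h_J 1_SP] ≤ Z₀(1+δ)·P(SP)`, and `E[F] − E[F 1_SP] ∈ [0, P(¬SP)]`;
the rest is the elementary `ratio_arith` (`≤ 4δ + 2P(¬SP)`).

Also: `smallPlaquettes_gaugeTransformZd` (gauge invariance of `SP`), `measurableSet_smallPlaquettes`, `measurable_spIndicator`, `ae_coldWall`.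
Tree + Mathlib; no definitions; standard axioms.  HONEST LABEL: a support brick (STEP 2 §2(c)) of the XL stub S5 (LINE-19 ⟨stmt-QuantumFields-24004⟩
/⟨24335⟩; U5 ⟨24336⟩); S5/U5 and route AllWindowsColdBox (DRAFT) remain OPEN; the Yang–Mills mass gap is NOT proved by this file; no summit is
proved by a line.  Seat ym-line-fcl-p3 g25.
-/

set_option autoImplicit false

noncomputable section

open MeasureTheory
open Literature.Probability.LatticeModels (Site)
open Literature.MathematicalPhysics.QuantumFieldTheory (isSpecification_ymSpecification_of_t2Space)
open Literature.MathematicalPhysics.QuantumFieldTheory.AxialGauge (boxEdges)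
open Literature.MathematicalPhysics.QuantumLattice
open Summit.QuantumFields.YangMills.Theorems.WeakCouplingRates (boxState plaqCostAt measurable_plaqCostAt)

namespace Summit.QuantumFields.YangMills.Theorems.AllWindowsColdBoxBoxHighLine


open FPRep FPExact

/-- ★★★ **T-S5.5J `fpRepresentation : FPRepresentation`** (planner ym-idea-2 g18's typed Prop, BY NAME): for a gauge-invariant `0 ≤ F ≤ 1`,
`|E_box[F] − E_box[F h_J 1_SP]/E_box[h_J 1_SP]| ≤ 4δ + 4·P_box(¬SP)` given the Landau representative (i) and the orbit-normaliser precision (ii).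
[folklore] -/
theorem fpRepresentation : FPRepresentation := by
  intro H β r r₀ spl δ hH hβ hδ0 hδ hrep hN F hFinv hFm hF0 hF1
  haveI := isProbabilityMeasure_boxState β H
  set μ := boxState (fundamentalRep (Fin 2)) β H with hμ
  set h := jacWeight β H r with hh
  set S := spIndicator H spl with hS
  set Z := laplaceZ0 β H with hZ
  have hZ0 : 0 < Z := laplaceZ0_pos H hβ
  have h1δ : 0 < 1 - δ := by linarith
  have hZl : 0 < Z * (1 - δ) := mul_pos hZ0 h1δ
  have hZu : 0 < Z * (1 + δ) := by positivity
  -- the weight: measurable, `0 ≤ h ≤ M`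
  have hhm : Measurable h := measurable_jacWeight β H r
  have hh0 : ∀ U, 0 ≤ h U := jacWeight_nonneg β H r
  obtain ⟨CM, _, hMle⟩ := jacWeight_le hβ.le H r
  set M := Real.exp (CM * (interiorSites H).card * (1 + Real.log ((interiorSites H).card))) with hM
  have hhM : ∀ U, h U ≤ M := hMle
  have hM0 : 0 ≤ M := (hh0 1).trans (hhM 1)
  -- the indicator: measurable, `0 ≤ S ≤ 1`, gauge invariant
  have hSm : Measurable S := measurable_spIndicator H spl
  have hS01 : ∀ U, 0 ≤ S U ∧ S U ≤ 1 := spIndicator_mem_Icc H spl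
  have hSinv : ∀ g : InteriorGauge H, ∀ U, S (gaugeTransformZd (extendGauge H g) U) = S U :=
    fun g U => spIndicator_gaugeTransformZd H spl _ U
  -- the orbit normaliser on `SP ∩ ColdWall`
  set N := orbitAverage H h with hNdef
  have hNm : Measurable N := measurable_orbitAverage H hhm
  have hNsp : ∀ U, ColdWall H U → SmallPlaquettes H spl U → Z * (1 - δ) ≤ N U ∧ N U ≤ Z * (1 + δ) := by
    intro U hU hsp
    obtain ⟨g, hg, hL, hlinks⟩ := hrep U hU hsp
    have hmain := hN _ hL hlinks
    have hinv : N (gaugeTransformZd g U) = N U := orbitAverage_gaugeTransformZd_of_isInteriorGauge H h hg U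
    rw [hinv] at hmain
    obtain ⟨h1, h2⟩ := abs_le.1 hmain
    have hlow : 1 - δ ≤ N U / Z := by linarith
    have hup : N U / Z ≤ 1 + δ := by linarith
    rw [le_div_iff₀ hZ0] at hlow
    rw [div_le_iff₀ hZ0] at hup
    constructor <;> linarith
  -- cold wall almost surely
  have hae : ∀ᵐ U ∂μ, ColdWall H U := ae_coldWall β H
  -- integrability of the bounded observables
  have hFi : Integrable F μ :=
    Integrable.of_bound hFm.aestronglyMeasurable 1 (ae_of_all _ fun U => by
      rw [Real.norm_eq_abs, abs_of_nonneg (hF0 U)]; exact hF1 U)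
  have hFSm : Measurable fun U => F U * S U := hFm.mul hSm
  have hFS01 : ∀ U, 0 ≤ F U * S U ∧ F U * S U ≤ 1 := fun U =>
    ⟨mul_nonneg (hF0 U) (hS01 U).1, by nlinarith [hF0 U, hF1 U, (hS01 U).1, (hS01 U).2]⟩
  have hFSi : Integrable (fun U => F U * S U) μ :=
    Integrable.of_bound hFSm.aestronglyMeasurable 1 (ae_of_all _ fun U => by
      rw [Real.norm_eq_abs, abs_of_nonneg (hFS01 U).1]; exact (hFS01 U).2)
  have hSi : Integrable S μ :=
    Integrable.of_bound hSm.aestronglyMeasurable 1 (ae_of_all _ fun U => by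
      rw [Real.norm_eq_abs, abs_of_nonneg (hS01 U).1]; exact (hS01 U).2)
  have hFSinv : ∀ g : InteriorGauge H, ∀ U,
      F (gaugeTransformZd (extendGauge H g) U) * S (gaugeTransformZd (extendGauge H g) U) = F U * S U := by
    intro g U; rw [hFinv g U, hSinv g U]
  -- ★ the exact FP identities for `F·1_SP` and `1_SP`
  have hI₁ := integral_mul_div_orbitAverage_eq β H (fun U => F U * S U) h hFSinv hFSi hhm hh0 ⟨M, hhM⟩
  have hI₂ := integral_mul_div_orbitAverage_eq β H S h hSinv hSi hhm hh0 ⟨M, hhM⟩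
  -- on the cold wall, `G · 1_{N ≠ 0} = G` for `G` supported on `SP`
  have hind : ∀ U, ColdWall H U → S U * (if N U = 0 then (0 : ℝ) else 1) = S U := by
    intro U hU
    by_cases hsp : SmallPlaquettes H spl U
    · have hpos : 0 < N U := lt_of_lt_of_le hZl (hNsp U hU hsp).1
      rw [if_neg hpos.ne', mul_one]
    · rw [show S U = 0 from spIndicator_of_not_mem hsp, zero_mul]
  have hA : ∫ U, (F U * S U) * (h U / N U) ∂μ = ∫ U, F U * S U ∂μ := by
    rw [hI₁]
    refine integral_congr_ae ?_
    filter_upwards [hae] with U hU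
    rw [mul_assoc, hind U hU]
  have hQ : ∫ U, S U * (h U / N U) ∂μ = ∫ U, S U ∂μ := by
    rw [hI₂]
    refine integral_congr_ae ?_
    filter_upwards [hae] with U hU
    exact hind U hU
  -- names for the five integrals
  set a := ∫ U, F U ∂μ with ha
  set A := ∫ U, F U * S U ∂μ with hAdef
  set q := ∫ U, S U ∂μ with hq
  set B := ∫ U, F U * (h U * S U) ∂μ with hB
  set D := ∫ U, h U * S U ∂μ with hD
  -- pointwise sandwiches on the cold wall
  have hpt : ∀ U, ColdWall H U → ∀ G : ℝ, 0 ≤ G →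
      G * (h U * S U) / (Z * (1 + δ)) ≤ (G * S U) * (h U / N U) ∧
        (G * S U) * (h U / N U) ≤ G * (h U * S U) / (Z * (1 - δ)) := by
    intro U hU G hG
    by_cases hsp : SmallPlaquettes H spl U
    · obtain ⟨hl, hu⟩ := hNsp U hU hsp
      have hNpos : 0 < N U := lt_of_lt_of_le hZl hl
      rw [show S U = 1 from spIndicator_of_mem hsp, mul_one, mul_one]
      constructor
      · rw [mul_div_assoc]
        exact mul_le_mul_of_nonneg_left (div_le_div_of_nonneg_left (hh0 U) hNpos hu) hG
      · rw [mul_div_assoc]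
        exact mul_le_mul_of_nonneg_left (div_le_div_of_nonneg_left (hh0 U) hZl hl) hG
    · rw [show S U = 0 from spIndicator_of_not_mem hsp]
      simp
  -- integrability of the sandwiched integrands (a.e. bounded by `M/(Z(1−δ))`)
  have hmidm : ∀ {G : LGConfig 4 SU2 → ℝ}, Measurable G → Measurable fun U => (G U * S U) * (h U / N U) :=
    fun hG => (hG.mul hSm).mul (hhm.div hNm)
  have hmidi : ∀ {G : LGConfig 4 SU2 → ℝ}, Measurable G → (∀ U, 0 ≤ G U ∧ G U ≤ 1) →
      Integrable (fun U => (G U * S U) * (h U / N U)) μ := by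
    intro G hG hG01
    refine Integrable.of_bound (hmidm hG).aestronglyMeasurable (M / (Z * (1 - δ))) ?_
    filter_upwards [hae] with U hU
    have hnn : 0 ≤ (G U * S U) * (h U / N U) :=
      mul_nonneg (mul_nonneg (hG01 U).1 (hS01 U).1) (div_nonneg (hh0 U) (orbitAverage_nonneg (H := H) hh0 U))
    rw [Real.norm_eq_abs, abs_of_nonneg hnn]
    refine le_trans ((hpt U hU (G U) (hG01 U).1).2) ?_
    rw [div_le_div_iff_of_pos_right hZl]
    calc G U * (h U * S U) ≤ 1 * (M * 1) := by
          apply mul_le_mul (hG01 U).2 _ (mul_nonneg (hh0 U) (hS01 U).1) zero_le_one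
          exact mul_le_mul (hhM U) (hS01 U).2 (hS01 U).1 hM0
      _ = M := by ring
  have hprodm : ∀ {G : LGConfig 4 SU2 → ℝ}, Measurable G → Measurable fun U => G U * (h U * S U) :=
    fun hG => hG.mul (hhm.mul hSm)
  have hprodi : ∀ {G : LGConfig 4 SU2 → ℝ}, Measurable G → (∀ U, 0 ≤ G U ∧ G U ≤ 1) →
      Integrable (fun U => G U * (h U * S U)) μ := by
    intro G hG hG01
    refine Integrable.of_bound (hprodm hG).aestronglyMeasurable M (ae_of_all _ fun U => ?_)
    have hnn : 0 ≤ G U * (h U * S U) := mul_nonneg (hG01 U).1 (mul_nonneg (hh0 U) (hS01 U).1)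
    rw [Real.norm_eq_abs, abs_of_nonneg hnn]
    calc G U * (h U * S U) ≤ 1 * (M * 1) := by
          apply mul_le_mul (hG01 U).2 _ (mul_nonneg (hh0 U) (hS01 U).1) zero_le_one
          exact mul_le_mul (hhM U) (hS01 U).2 (hS01 U).1 hM0
      _ = M := by ring
  have hF01 : ∀ U, 0 ≤ F U ∧ F U ≤ 1 := fun U => ⟨hF0 U, hF1 U⟩
  have h101 : ∀ U : LGConfig 4 SU2, (0 : ℝ) ≤ 1 ∧ (1 : ℝ) ≤ 1 := fun _ => ⟨zero_le_one, le_rfl⟩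
  -- the `F`-sandwich: `B/(Z(1+δ)) ≤ A ≤ B/(Z(1−δ))`
  have hB2 : Z * (1 - δ) * A ≤ B := by
    have : A ≤ B / (Z * (1 - δ)) := by
      rw [← hA, hB, ← integral_div]
      refine integral_mono_ae (hmidi hFm hF01) ((hprodi hFm hF01).div_const _) ?_
      filter_upwards [hae] with U hU
      exact (hpt U hU (F U) (hF0 U)).2
    have h' := (le_div_iff₀ hZl).1 this; linarith
  have hB1 : B ≤ Z * (1 + δ) * A := by
    have : B / (Z * (1 + δ)) ≤ A := by
      rw [← hA, hB, ← integral_div]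
      refine integral_mono_ae ((hprodi hFm hF01).div_const _) (hmidi hFm hF01) ?_
      filter_upwards [hae] with U hU
      exact (hpt U hU (F U) (hF0 U)).1
    have h' := (div_le_iff₀ hZu).1 this; linarith
  -- the `1`-sandwich: `D/(Z(1+δ)) ≤ q ≤ D/(Z(1−δ))`
  have hD2 : Z * (1 - δ) * q ≤ D := by
    have : q ≤ D / (Z * (1 - δ)) := by
      rw [← hQ, hD, ← integral_div]
      refine integral_mono_ae ?_ ?_ ?_
      · have := hmidi measurable_const h101; simpa only [one_mul] using this
      · have := (hprodi measurable_const h101).div_const (Z * (1 - δ)); simpa only [one_mul] using this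
      · filter_upwards [hae] with U hU
        have := (hpt U hU 1 zero_le_one).2
        simpa only [one_mul] using this
    have h' := (le_div_iff₀ hZl).1 this; linarith
  have hD1 : D ≤ Z * (1 + δ) * q := by
    have : D / (Z * (1 + δ)) ≤ q := by
      rw [← hQ, hD, ← integral_div]
      refine integral_mono_ae ?_ ?_ ?_
      · have := (hprodi measurable_const h101).div_const (Z * (1 + δ)); simpa only [one_mul] using this
      · have := hmidi measurable_const h101; simpa only [one_mul] using this
      · filter_upwards [hae] with U hU
        have := (hpt U hU 1 zero_le_one).1
        simpa only [one_mul] using this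
    have h' := (div_le_iff₀ hZu).1 this; linarith
  -- `q = P(SP) = 1 − P(¬SP)`
  have hSP : MeasurableSet {U : LGConfig 4 SU2 | SmallPlaquettes H spl U} := measurableSet_smallPlaquettes H spl
  set p := (μ {U | ¬ SmallPlaquettes H spl U}).toReal with hp
  have hqp : q = 1 - p := by
    have hq' : q = (μ {U | SmallPlaquettes H spl U}).toReal := by
      rw [hq, hS, spIndicator_eq_indicator, integral_indicator_one hSP, measureReal_def]
    have hcompl : {U : LGConfig 4 SU2 | ¬ SmallPlaquettes H spl U} = {U | SmallPlaquettes H spl U}ᶜ := rfl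
    rw [hq', hp, hcompl, prob_compl_eq_one_sub hSP, ENNReal.toReal_sub_of_le prob_le_one ENNReal.one_ne_top]
    simp
  have hp0 : 0 ≤ p := ENNReal.toReal_nonneg
  have hq0 : 0 ≤ q := by rw [hq]; exact integral_nonneg fun U => (hS01 U).1
  have hp1 : p ≤ 1 := by linarith
  -- `0 ≤ a ≤ 1`, `0 ≤ A ≤ q`, `A ≤ a ≤ A + p`
  have ha0 : 0 ≤ a := by rw [ha]; exact integral_nonneg hF0
  have ha1 : a ≤ 1 := by
    rw [ha]
    calc ∫ U, F U ∂μ ≤ ∫ _, (1 : ℝ) ∂μ := integral_mono hFi (integrable_const _) hF1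
      _ = 1 := by simp
  have hA0 : 0 ≤ A := by rw [hAdef]; exact integral_nonneg fun U => (hFS01 U).1
  have hAq : A ≤ 1 - p := by
    rw [← hqp, hAdef, hq]
    exact integral_mono hFSi hSi fun U => by nlinarith [hF0 U, hF1 U, (hS01 U).1]
  have haA : A ≤ a := by
    rw [hAdef, ha]
    exact integral_mono hFSi hFi fun U => by nlinarith [hF0 U, (hS01 U).2]
  have haAp : a ≤ A + p := by
    -- `F = F·S + F·(1 − S)` and `F(1−S) ≤ 1 − S`, `∫ (1 − S) = 1 − q = p`
    have hF1Si : Integrable (fun U => F U * (1 - S U)) μ := by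
      have := hFi.sub hFSi
      refine this.congr (ae_of_all _ fun U => ?_)
      simp only [Pi.sub_apply]; ring
    have h1Si : Integrable (fun U => 1 - S U) μ := (integrable_const 1).sub hSi
    have hsplit : a = A + ∫ U, F U * (1 - S U) ∂μ := by
      rw [ha, hAdef, ← integral_add hFSi hF1Si]
      refine integral_congr_ae (ae_of_all _ fun U => ?_)
      ring
    have hrest : ∫ U, F U * (1 - S U) ∂μ ≤ ∫ U, (1 - S U) ∂μ :=
      integral_mono hF1Si h1Si fun U => by nlinarith [hF0 U, hF1 U, (hS01 U).2]
    have hone : ∫ U, (1 - S U) ∂μ = 1 - q := by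
      rw [integral_sub (integrable_const _) hSi, ← hq]; simp
    linarith
  -- conclude
  rw [hqp] at hD1 hD2
  have := ratio_arith hZ0 hδ0 hδ hp0 hp1 ha0 ha1 hA0 hAq haA haAp hB1 hB2 hD1 hD2
  simpa only [ha, hB, hD, hp] using this


/-- ★★ **T-S5.5J in the window of ✓T-S5.4J, with S4b as the only hypothesis**: for `r₀ := K·H(1+log H)²·spl` (`K = √C_{4b}`),
`δ := e^{−cH⁴} ≤ 1/2`, in the window `C·H¹²(1+log β)⁸ ≤ β`, `C r₀ H² ≤ 1`, `r₀ + 1/(H⁴(1+log β)²) ≤ r`, `C r H ≤ 1`, and the S4b premise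
`spl·H⁴(1+log H)² ≤ c₀`: for every gauge-invariant measurable `0 ≤ F ≤ 1`,
`|E_box[F] − E_box[F h_J 1_SP]/E_box[h_J 1_SP]| ≤ 4e^{−cH⁴} + 4·P_box(¬SP)`.
From ✓`fpRepresentation`, ✓`orbitNormaliserJacobianR` (T-S5.4J) and the hypothesis `LandauBootstrapBound` (S4b). [folklore] -/
theorem fpRepresentation_window (h4b : LandauBootstrapBound) :
    ∃ K C c c₀ : ℝ, 0 < K ∧ 0 < C ∧ 0 < c ∧ 0 < c₀ ∧ ∀ H : ℕ, 1 ≤ H → ∀ β spl r : ℝ, 2 ≤ β →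
      C * (H : ℝ) ^ 12 * (1 + Real.log β) ^ 8 ≤ β → Real.exp (-(c * (H : ℝ) ^ 4)) ≤ 1 / 2 →
      0 ≤ spl → spl * (H : ℝ) ^ 4 * (1 + Real.log H) ^ 2 ≤ c₀ →
      C * (K * H * (1 + Real.log H) ^ 2 * spl) * (H : ℝ) ^ 2 ≤ 1 →
      K * H * (1 + Real.log H) ^ 2 * spl + 1 / ((H : ℝ) ^ 4 * (1 + Real.log β) ^ 2) ≤ r → C * r * H ≤ 1 →
      ∀ F : LGConfig 4 SU2 → ℝ, (∀ g : InteriorGauge H, ∀ U, F (gaugeTransformZd (extendGauge H g) U) = F U) →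
        Measurable F → (∀ U, 0 ≤ F U) → (∀ U, F U ≤ 1) →
        |(∫ U, F U ∂(boxState (fundamentalRep (Fin 2)) β H)) -
            (∫ U, F U * (jacWeight β H r U * spIndicator H spl U) ∂(boxState (fundamentalRep (Fin 2)) β H)) /
              (∫ U, jacWeight β H r U * spIndicator H spl U ∂(boxState (fundamentalRep (Fin 2)) β H))| ≤
          4 * Real.exp (-(c * (H : ℝ) ^ 4)) + 4 * ((boxState (fundamentalRep (Fin 2)) β H) {U | ¬ SmallPlaquettes H spl U}).toReal := by
  obtain ⟨C₄, c₀, hC₄, hc₀, h4⟩ := h4b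
  obtain ⟨C, c, hC, hc, hR⟩ := orbitNormaliserJacobianR
  refine ⟨Real.sqrt C₄, C, c, c₀, Real.sqrt_pos.2 hC₄, hC, hc, hc₀, ?_⟩
  intro H hH β spl r hβ hwin hδ hspl hprem hr₀C hgap hrC F hFinv hFm hF0 hF1
  set r₀ : ℝ := Real.sqrt C₄ * H * (1 + Real.log H) ^ 2 * spl with hr₀
  have hHr : (1 : ℝ) ≤ (H : ℝ) := by exact_mod_cast hH
  have hlogH : 0 ≤ 1 + Real.log (H : ℝ) := by linarith [Real.log_nonneg hHr]
  have hr₀0 : 0 ≤ r₀ := by rw [hr₀]; positivity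
  have hr₀sq : r₀ ^ 2 = C₄ * (H : ℝ) ^ 2 * (1 + Real.log H) ^ 4 * spl ^ 2 := by
    rw [hr₀]
    have := Real.sq_sqrt hC₄.le
    ring_nf
    rw [this]
    ring
  refine fpRepresentation H β r r₀ spl (Real.exp (-(c * (H : ℝ) ^ 4))) hH (by linarith) (Real.exp_pos _).le hδ
    ?_ ?_ F hFinv hFm hF0 hF1
  · -- (i) the Landau representative from S4b
    intro U hU hsp
    obtain ⟨g, hg, hL, hlinks⟩ := h4 H hH spl hspl hprem U hU hsp
    exact ⟨g, hg, hL, fun e he => (hlinks e he).trans_eq hr₀sq.symm⟩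
  · -- (ii) the orbit-normaliser precision from T-S5.4J
    intro V hV hlinks
    exact hR H hH β r₀ r hβ hwin hr₀0 hr₀C hgap hrC V hV hlinks

end Summit.QuantumFields.YangMills.Theorems.AllWindowsColdBoxBoxHighLine

end
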